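import Summits.ResolutionOfSingularities.ResolutionOfSingularities.Theorems.MarkedTransferCampaignW46StringReadingReduction
import HarnessLib

/-!
# [OURS · L1 W4.6 rung (ii)] THE (M) AND (M⁺) INSTANCES of the reading-generic reductions; RUNG (ii) UNDER READING (M⁺)
# (`m := t + 1`, free of the `t = 0` edge) — whole-∇, component-wise, with the typed candidate, in the host's words (proofs)

Cell res-hironaka, LADDER-RESOLUTION rung L (D-0089), slot W4.6, rung (ii); seat res-L1-s46-pv-3 (gen 2). Host route
MarkedTransfer, host item `HypersurfaceOrderReductionDimLeThree` (stmt-16156); `--kind proof --supports` it. Companion of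
`…StringReading` (string readings, generic shapes), `…StringReadingReduction` (generic reductions), Threefolds.lean v5
(`Step.EqualitySucc`, `EqualityAlongStepsSucc`, `DecreaseIISucc`, `EqualityIISucc`) and the shared module v4 / anchors v3
(`DecreaseAlongStepsSucc`, `primeRSucc`, `decreaseAlongStepsSucc_of_thm16_6`).

HONEST FRAMING. Everything below is OURS: pure logic over the campaign shapes; NOTHING here is a statement of H. Hironaka's
manuscript (2017-03-23, [Hironaka2017]) and nothing asserts that any statement of it holds. All shapes are HYPOTHESES; the
typed `Thm16_6` enters only as a hypothesis. Neither reading (M)/(M⁺) is preferred. AI review is weaker than expert review.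

## Contents

* INSTANCE LEMMAS (M): `DecreaseAlongSteps → (readingM N).DecreaseShape`, `EqualityAlongSteps → StopsMonotone →
  (readingM N).PrefixShape`, `StopsMonotone → (readingM N).StopsShape`, `NablaTopSing → (readingM N).TopSingShape`,
  `OffCentreMonotone → (readingM N).MonotoneShape` (all by unfolding; with them the generic engine re-proves the landed (M)
  theorems verbatim — not restated here, dedup).
* INSTANCE LEMMAS (M⁺): `DecreaseAlongStepsSucc → (readingMSucc N).DecreaseShape`, `EqualityAlongStepsSucc → StopsMonotone →
  (readingMSucc N).PrefixShape` (Eq. (128) at length `t + 1` read back at `t′ + 1 ≤ t + 1`), `StopsMonotone →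
  (readingMSucc N).StopsShape`; anchor `equalityAlongStepsSucc_of_thm16_6` (the typed candidate with `prime := primeRSucc`
  gives the (M⁺) Eq. (128)-shape in every regime; twin of `equalityAlongSteps_of_thm16_6`).
* RUNG (ii) UNDER (M⁺): `terminatesWholeII_of_decreaseSucc`, `terminatesNablaII_of_decreaseSucc` (`DecreaseIISucc →
  EqualityIISucc → StopsMonotoneII → (readingMSucc N).TopSingShape Rd regimeII → (readingMSucc N).MonotoneShape Rd regimeII →
  TerminatesNablaII`, dimension bound `3` consumed by the measure), `terminatesNablaII_of_thm16_6Succ` (typed `Thm16_6 n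
  (primeRSucc N Rd) _` AS A HYPOTHESIS), and the host-words form `not_divergesFromNabla_hostState_of_shapesSucc`.

References: `…StringReading`, `…StringReadingReduction`; Threefolds.lean v5 (p485187); shared module v4 (p479675) + anchors
v3 (p480427); `…ThreefoldsRegime` (p480316). H. Hironaka, ms. 2017-03-23, Th. 16.6 p.84 l.10–28, Cor. 16.9 p.85 l.31–35,
§16.3 p.87 — scope only, under adjudication, not cited as fact. [Hironaka2017]
-/

noncomputable section

set_option linter.dupNamespace false -- mandated namespace of this single-conjunct summit

open CategoryTheory AlgebraicGeometry TopologicalSpace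

namespace Summit.ResolutionOfSingularities.ResolutionOfSingularities.Theorems

namespace CampaignW46

open Literature.AlgebraicGeometry.Resolution
open Literature.AlgebraicGeometry.Hironaka2017
open Literature.AlgebraicGeometry.Hironaka2017.S02Preliminaries
open Literature.AlgebraicGeometry.Hironaka2017.Datum
open Literature.AlgebraicGeometry.Hironaka2017.S15ARSchemes
open Literature.AlgebraicGeometry.Hironaka2017.S16Proof
open Literature.AlgebraicGeometry.Hironaka2017.InvStringOrder

universe u

variable {n : ℕ} {p : ℕ} [Fact p.Prime] {K : Type u} [Field K] [CharP K p]

/-! ## Anchor: the (M⁺) Eq. (128)-shape from the typed candidate -/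

/-- **Anchor (pure logic), reading (M⁺).** The typed candidate Th. 16.6 (`S16Proof.Thm16_6`, any part-(4) parameter) with its
`prime` parameter read as `primeRSucc N Rd` implies `EqualityAlongStepsSucc N Rd Rg` for EVERY regime (its part (3) at
`R.mtiSucc`); twin of `equalityAlongSteps_of_thm16_6`, companion of the shared anchor `decreaseAlongStepsSucc_of_thm16_6`.
The candidate occurs only as the hypothesis `h`. [folklore] -/
theorem equalityAlongStepsSucc_of_thm16_6 [PerfectField K] (N : Notions.{u} n) (Rd : Reading p K N)
    {pPosiEmptyAt : ∀ {W : Scheme.{u}}, IdealExponent W → W → Prop}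
    (h : Thm16_6 (p := p) (K := K) n (primeRSucc N Rd) pPosiEmptyAt) (Rg : Regime p K) :
    EqualityAlongStepsSucc N Rd Rg := by
  intro A E R _ _ A' s R' hR'
  have key := h A R.mtiSucc s.D s.π (fun _ => R'.mtiSucc) R.mtiSucc_isStandard s.centre.subset_nabla
    s.centre.irreducible s.centre.smooth s.blowup ⟨A'.hom, A'.irreducible, A'.smooth, A'.quasiCompact, R', hR', fun _ => rfl⟩
  exact key.2.2.1

/-! ## The (M) instances of the generic shapes -/

section InstM

variable {N : Notions.{u} n} {Rd : Reading p K N} {Rg : Regime p K}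

/-- (M): `DecreaseAlongSteps` gives the generic decrease shape of `readingM` (Eq. (127) at the closed points over the
centre off `D′ = ∇′ ∩ π⁻¹(D)`). [folklore] -/
theorem decreaseShape_readingM (h : DecreaseAlongSteps N Rd Rg) : (readingM N).DecreaseShape Rd Rg :=
  fun A E R hRg hRd A' s R' hRd' ξ' hξ' hD hnot =>
    (h A E R hRg hRd A' s R' hRd').1 ξ' hξ' hD fun hDP => hnot hDP.1

/-- (M): `EqualityAlongSteps` (Eq. (128), both strings at length `m`) and `StopsMonotone` (`m′ ≤ m`) give the generic prefix
shape of `readingM` (`invStr_eq_take`). [folklore] -/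
theorem prefixShape_readingM (hEq : EqualityAlongSteps N Rd Rg) (hM : StopsMonotone N Rd Rg) :
    (readingM N).PrefixShape Rd Rg := by
  intro A E R hRg hRd A' s R' hRd' ξ' hξ' hDP
  have h128 : Eq128 R.mti (s.π ξ') R'.mti ξ' := (hEq A E R hRg hRd A' s R' hRd') ξ' hξ' hDP
  have hm' : R'.m ≤ R.m := hM A E R hRg hRd A' s R' hRd'
  change R'.mti.invStr R'.m ξ' = (R.mti.invStr R.m (s.π ξ')).take R'.m
  rw [invStr_eq_take R'.mti hm' ξ']
  exact congrArg (fun L => List.take R'.m L) h128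

/-- (M): `StopsMonotone` is the generic stops shape of `readingM`. [folklore] -/
theorem stopsShape_readingM (h : StopsMonotone N Rd Rg) : (readingM N).StopsShape Rd Rg :=
  fun A E R hRg hRd A' s R' hRd' => h A E R hRg hRd A' s R' hRd'

/-- (M): `NablaTopSing` is the generic top-stratum shape of `readingM`. [folklore] -/
theorem topSingShape_readingM (h : NablaTopSing N Rd Rg) : (readingM N).TopSingShape Rd Rg :=
  fun A E R hRg hRd => h A E R hRg hRd

/-- (M): `OffCentreMonotone` is the generic monotone shape of `readingM`. [folklore] -/
theorem monotoneShape_readingM (h : OffCentreMonotone N Rd Rg) : (readingM N).MonotoneShape Rd Rg :=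
  fun A E R hRg hRd A' s R' hRd' ξ' hξ' hD => h A E R hRg hRd A' s R' hRd' ξ' hξ' hD

end InstM

/-! ## The (M⁺) instances of the generic shapes -/

section InstMSucc

variable {N : Notions.{u} n} {Rd : Reading p K N} {Rg : Regime p K}

/-- (M⁺): `DecreaseAlongStepsSucc` gives the generic decrease shape of `readingMSucc` (Eq. (127) with strings of length
`t′ + 1`, `t + 1` at the closed points over the centre off `D′`; `D′` is the same locus under both readings,
`Resume.mtiSucc_DPrime`). [folklore] -/
theorem decreaseShape_readingMSucc (h : DecreaseAlongStepsSucc N Rd Rg) : (readingMSucc N).DecreaseShape Rd Rg :=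
  fun A E R hRg hRd A' s R' hRd' ξ' hξ' hD hnot =>
    (h A E R hRg hRd A' s R' hRd').1 ξ' hξ' hD fun hDP => hnot hDP.1

/-- (M⁺): `EqualityAlongStepsSucc` (Eq. (128), both strings at length `t + 1`) and `StopsMonotone` (`t′ ≤ t`, hence
`t′ + 1 ≤ t + 1`) give the generic prefix shape of `readingMSucc`. [folklore] -/
theorem prefixShape_readingMSucc (hEq : EqualityAlongStepsSucc N Rd Rg) (hM : StopsMonotone N Rd Rg) :
    (readingMSucc N).PrefixShape Rd Rg := by
  intro A E R hRg hRd A' s R' hRd' ξ' hξ' hDP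
  have h128 : Eq128 R.mtiSucc (s.π ξ') R'.mtiSucc ξ' := (hEq A E R hRg hRd A' s R' hRd') ξ' hξ' hDP
  have hm' : R'.mSucc ≤ R.mSucc := Nat.succ_le_succ (hM A E R hRg hRd A' s R' hRd')
  change R'.mtiSucc.invStr R'.mSucc ξ' = (R.mtiSucc.invStr R.mSucc (s.π ξ')).take R'.mSucc
  rw [invStr_eq_take R'.mtiSucc hm' ξ']
  exact congrArg (fun L => List.take R'.mSucc L) h128

/-- (M⁺): `StopsMonotone` (`t′ ≤ t`) gives the generic stops shape of `readingMSucc` (`t′ + 1 ≤ t + 1`). [folklore] -/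
theorem stopsShape_readingMSucc (h : StopsMonotone N Rd Rg) : (readingMSucc N).StopsShape Rd Rg :=
  fun A E R hRg hRd A' s R' hRd' => Nat.succ_le_succ (h A E R hRg hRd A' s R' hRd')

end InstMSucc

/-! ## The reductions under reading (M⁺), general regime -/

section ReductionSucc

variable {N : Notions.{u} n} {Rd : Reading p K N} {Rg : Regime p K}

/-- **WHOLE-∇ REDUCTION UNDER (M⁺) (general regime).** `DecreaseAlongStepsSucc → StopsMonotone →
(readingMSucc N).TopSingShape → (readingMSucc N).MonotoneShape → TerminatesWhole`. [folklore] -/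
theorem terminatesWhole_of_decreaseSucc (hD : DecreaseAlongStepsSucc N Rd Rg) (hM : StopsMonotone N Rd Rg)
    (hT : (readingMSucc N).TopSingShape Rd Rg) (hL : (readingMSucc N).MonotoneShape Rd Rg) : TerminatesWhole N Rd Rg :=
  (readingMSucc N).terminatesWhole_of_shapes (decreaseShape_readingMSucc hD) (stopsShape_readingMSucc hM) hT hL

/-- **COMPONENT-WISE REDUCTION UNDER (M⁺)** (regime inside `dimLE d`): `DecreaseAlongStepsSucc → EqualityAlongStepsSucc →
StopsMonotone → (readingMSucc N).TopSingShape → (readingMSucc N).MonotoneShape → TerminatesNabla`. [folklore] -/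
theorem terminatesNabla_of_decreaseSucc {d : ℕ} (hdim : ∀ A E, Rg A E → Regime.dimLE d A E)
    (hD : DecreaseAlongStepsSucc N Rd Rg) (hEq : EqualityAlongStepsSucc N Rd Rg) (hM : StopsMonotone N Rd Rg)
    (hT : (readingMSucc N).TopSingShape Rd Rg) (hL : (readingMSucc N).MonotoneShape Rd Rg) : TerminatesNabla N Rd Rg :=
  (readingMSucc N).terminatesNabla_of_shapes hdim (decreaseShape_readingMSucc hD) (prefixShape_readingMSucc hEq hM)
    (stopsShape_readingMSucc hM) hT hL

/-- The (M⁺) component-wise reduction with BOTH one-step shapes from the typed candidate `Thm16_6` read with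
`prime := primeRSucc N Rd` (a HYPOTHESIS; anchors `decreaseAlongStepsSucc_of_thm16_6`, `equalityAlongStepsSucc_of_thm16_6`).
[folklore] -/
theorem terminatesNabla_of_thm16_6Succ [PerfectField K] {d : ℕ} (hdim : ∀ A E, Rg A E → Regime.dimLE d A E)
    {pPosiEmptyAt : ∀ {W : Scheme.{u}}, IdealExponent W → W → Prop}
    (h : Thm16_6 (p := p) (K := K) n (primeRSucc N Rd) pPosiEmptyAt) (hM : StopsMonotone N Rd Rg)
    (hT : (readingMSucc N).TopSingShape Rd Rg) (hL : (readingMSucc N).MonotoneShape Rd Rg) : TerminatesNabla N Rd Rg :=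
  terminatesNabla_of_decreaseSucc hdim (decreaseAlongStepsSucc_of_thm16_6 N Rd h Rg)
    (equalityAlongStepsSucc_of_thm16_6 N Rd h Rg) hM hT hL

end ReductionSucc

/-! ## Rung (ii) under reading (M⁺) -/

section RungIISucc

variable (N : Notions.{u} n) (Rd : Reading p K N)

/-- **RUNG (ii), whole-∇ form, UNDER (M⁺).** `DecreaseIISucc → StopsMonotoneII → (readingMSucc N).TopSingShape Rd regimeII →
(readingMSucc N).MonotoneShape Rd regimeII → TerminatesWholeII`. [folklore] -/
theorem terminatesWholeII_of_decreaseSucc (hD : DecreaseIISucc N Rd) (hM : StopsMonotoneII N Rd)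
    (hT : (readingMSucc N).TopSingShape Rd regimeII) (hL : (readingMSucc N).MonotoneShape Rd regimeII) :
    TerminatesWholeII N Rd :=
  terminatesWhole_of_decreaseSucc hD hM hT hL

/-- **RUNG (ii), ∇-CENTRED (registered shape), UNDER READING (M⁺)** — free of the `t = 0` edge of `DecreaseII`. For the
NAMED `N`, `Rd`: `DecreaseIISucc → EqualityIISucc → StopsMonotoneII → (readingMSucc N).TopSingShape Rd regimeII →
(readingMSucc N).MonotoneShape Rd regimeII → TerminatesNablaII`; the dimension bound `3` of `regimeII` (first binder of
stmt-16156) makes the component measure well-founded. [folklore] -/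
theorem terminatesNablaII_of_decreaseSucc (hD : DecreaseIISucc N Rd) (hEq : EqualityIISucc N Rd)
    (hM : StopsMonotoneII N Rd) (hT : (readingMSucc N).TopSingShape Rd regimeII)
    (hL : (readingMSucc N).MonotoneShape Rd regimeII) : TerminatesNablaII N Rd :=
  terminatesNabla_of_decreaseSucc (d := 3) (fun _ _ h => h.1) hD hEq hM hT hL

/-- RUNG (ii), ∇-centred, UNDER (M⁺), with the typed candidate `Thm16_6 n (primeRSucc N Rd) _` AS A HYPOTHESIS:
`Thm16_6 → StopsMonotoneII → TopSingShape → MonotoneShape → TerminatesNablaII`. [folklore] -/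
theorem terminatesNablaII_of_thm16_6Succ [PerfectField K]
    {pPosiEmptyAt : ∀ {W : Scheme.{u}}, IdealExponent W → W → Prop}
    (h : Thm16_6 (p := p) (K := K) n (primeRSucc N Rd) pPosiEmptyAt) (hM : StopsMonotoneII N Rd)
    (hT : (readingMSucc N).TopSingShape Rd regimeII) (hL : (readingMSucc N).MonotoneShape Rd regimeII) :
    TerminatesNablaII N Rd :=
  terminatesNabla_of_thm16_6Succ (d := 3) (fun _ _ h => h.1) h hM hT hL

end RungIISucc

section HostSucc

variable {k : Type u} [Field k] [CharP k p] {N : Notions.{u} n} {Rd : Reading p k N}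

/-- **RUNG (ii) IN THE WORDS OF THE HOST ITEM, UNDER READING (M⁺)**: `DecreaseIISucc ∧ EqualityIISucc ∧ StopsMonotoneII ∧
(readingMSucc N).TopSingShape Rd regimeII ∧ (readingMSucc N).MonotoneShape Rd regimeII` for the named `N`, `Rd` imply that
from every input `(k, X, I, m)` of stmt-16156 (`k` perfect of characteristic `p`, `X` integral regular locally of finite
type quasi-compact over `k` of Krull dimension `≤ 3`, `I` effective Cartier, `m`) the ∇-centred typed procedure admits no
infinite run. All shapes are HYPOTHESES; 16156's conclusion is neither used nor derived. [folklore] -/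
theorem not_divergesFromNabla_hostState_of_shapesSucc [PerfectField k] (hD : DecreaseIISucc N Rd)
    (hEq : EqualityIISucc N Rd) (hM : StopsMonotoneII N Rd) (hT : (readingMSucc N).TopSingShape Rd regimeII)
    (hL : (readingMSucc N).MonotoneShape Rd regimeII) (X : Scheme.{u}) (s : X ⟶ Spec (.of k)) [LocallyOfFiniteType s]
    [QuasiCompact s] [IsIntegral X] (hreg : Scheme.IsRegular X) (hdim : topologicalKrullDim X ≤ 3)
    (I : X.IdealSheafData) (hIc : IsEffectiveCartier I) (m : ℕ) (Rg : Regime p k) :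
    ¬ DivergesFromNabla N Rd Rg
        (⟨X, s, inferInstance, smooth_of_isRegular_of_perfectField s hreg, inferInstance⟩ : AmbientDatum p k) ⟨I, m⟩ :=
  not_divergesFromNabla_hostState (terminatesNablaII_of_decreaseSucc N Rd hD hEq hM hT hL) X s hreg hdim I hIc m Rg

end HostSucc

end CampaignW46

end Summit.ResolutionOfSingularities.ResolutionOfSingularities.Theorems

end
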